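import Summits.Ventures.Crystal3D.Theorems.StickyWulffConstantGenericWallFloorConeCertRhoAtP5
import Summits.Ventures.Crystal3D.Theorems.StickyWulffConstantGenericWallFloorConeCertRhoP5
import HarnessLib

/-!
# E1 in CERTIFIED NORMAL FORM, part 1: the P₅ exhaustion statement `P5Exhaustion` and the transported tube step
# (crux `GenericWallFloor`, stmt-Ventures-19480, line `WallLedgerG`; input E1 of lanes G / F / T)

HONEST FRAMING. Venture `Summits/Ventures/Crystal3D` (cell `crystal3d-full`), helper `--supports` the crux
`GenericWallFloor` of `route-Ventures-StickyWulffConstant`, REGISTERED line `WallLedgerG`, open stub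
`stub_twoSlabAdhesion`.  Rung credit only; F-C1 not moved; NOT the crux.

Every general-filling ledger of lanes G, F and T takes the E1 row «the closed vertex star P₅ (fcc orbit C12-55 ≅ hcp
orbit A12-451) is EXACT-ONLY» BY NAME, as `hcert : ExactOnly 0 (fccSlots.filter fun w => 0 < ⟪w, s₀⟫)`.  Its
certification has two halves (cf-p1 ROUTE §80, `…ExhaustionGlue`): INSIDE the tube of each of the three special
completions (one cuboctahedral, two twin) the completion is unique — KERNEL, the landed cone certificates
`cert_C12_55` / `cert_A12_451` with per-ball radii (`…ConeCertDataP5`, `…ConeCertRhoAtP5`, `…ConeCertRhoP5`,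
`ConeCert.eq_slotSet_of_slotMatched` of `…ConeCertificateRhoPerBall`); OUTSIDE the tubes there is nothing —
the branch and bound R38 of cf-p2 (PREREG §34.R2, 2026-08-28T07:39Z: row A12-451 B&B-CERTIFIED, 57 pieces,
4.89·10⁸ nodes, every cell refuted or inside a tube; C12-55 corroboration).  This file and its sequel
`…GenericWallFloorOfP5Exhaustion` do for E1 what `…StarPairFar` did for the double-end input: they state the
outside-tube half as ONE named `Prop` in the kernel's own tube currency and prove its consequence.

* integer data: the own pattern `p5OwnInt` (closed star of `(−1,−1,0)` in `fccInt`), the three free parts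
  `p5FccInt` (scale `√2`), `p5TwinAInt`, `p5TwinBInt` (scale `√18`; the cuboctahedral free part with one triangle
  rotated by `60°` about `(1,1,±1)`), the signed coordinate permutations `p5IsoAInt/BInt` carrying `hcpInt` onto
  `3·p5OwnInt ∪ p5Twin?Int` and the slots / own vectors of `cert_A12_451` along — ONE `decide` (`p5_tables`);
* `p5IsoA`, `p5IsoB` — the same maps as linear isometries of `ℝ³`;
* `p5Own`, `p5SpecFcc`, `p5SpecTwinA`, `p5SpecTwinB` — the real patterns; `p5RadFcc/TwinA/TwinB` — the per-slot
  tube radii of the LANDED per-ball theorems (fcc `(74,141,141,74,141,141,201)/1000` in the slot order of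
  `cert_C12_55`; twins `(108,115,115,108,106,96,133)/1000` in the slot order of `cert_A12_451`, transported);
* **`P5Exhaustion`** — every twelve-point kissing completion `N ⊇ p5Own` has free part `N ∖ p5Own` SLOT-MATCHED
  (`SlotMatched`: a bijection moving each point by less than the radius of its slot) to one of the three special
  completions.  This is the named computational hypothesis; `p5Exhaustion_of_uniform` accepts the uniform-radius
  reading (`74/1000`, `96/1000`) as well;
* `SlotMatched.image_linearIsometryEquiv`, **`sdiff_eq_of_coneCert`** — the tube step for one special completion
  transported by a linear isometry carrying the certificate's active own balls into the own pattern.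

WHAT THIS IS NOT: no certificate is proved here (the B&B is a certified computation, cf-p2 R38); the consequence
`P5Exhaustion → ExactOnly` is in the sequel; F-C1 not moved.
-/

noncomputable section

namespace Summit.Ventures.Crystal3D.Theorems

open Finset Literature.Geometry.DiscreteGeometry
open scoped RealInnerProductSpace

/-! ### Integer data -/

/-- The P₅ own pattern in cubic integer coordinates (scale `√2`): the closed vertex star of `(−1,−1,0)` in the
cuboctahedron `fccInt` — the five own balls of the certificate `cert_C12_55`. -/
def p5OwnInt : Finset (Fin 3 → ℤ) :=
  {![-1, -1, 0], ![-1, 0, 1], ![-1, 0, -1], ![0, -1, 1], ![0, -1, -1]}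

/-- The free part of the CUBOCTAHEDRAL completion of P₅ (scale `√2`): the seven slots of `cert_C12_55`. -/
def p5FccInt : Finset (Fin 3 → ℤ) :=
  {![-1, 1, 0], ![0, 1, -1], ![0, 1, 1], ![1, -1, 0], ![1, 0, -1], ![1, 0, 1], ![1, 1, 0]}

/-- The free part of the FIRST TWIN completion of P₅ (scale `√18`): the cuboctahedral free part with the triangle
`{(1,1,0),(1,0,1),(0,1,1)}` rotated by `60°` about `(1,1,1)`. -/
def p5TwinAInt : Finset (Fin 3 → ℤ) :=
  {![-3, 3, 0], ![0, 3, -3], ![3, 0, -3], ![3, -3, 0], ![1, 1, 4], ![1, 4, 1], ![4, 1, 1]}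

/-- The free part of the SECOND TWIN completion of P₅ (scale `√18`): the cuboctahedral free part with the triangle
`{(1,1,0),(1,0,−1),(0,1,−1)}` rotated by `60°` about `(1,1,−1)`. -/
def p5TwinBInt : Finset (Fin 3 → ℤ) :=
  {![-3, 3, 0], ![0, 3, 3], ![3, 0, 3], ![3, -3, 0], ![1, 1, -4], ![1, 4, -1], ![4, 1, -1]}

/-- The signed coordinate permutation `(x₀,x₁,x₂) ↦ (−x₂, −x₀, −x₁)` on integer vectors (carries the frame of
`cert_A12_451` to the first twin completion of P₅). -/
def p5IsoAInt (v : Fin 3 → ℤ) : Fin 3 → ℤ := ![-v 2, -v 0, -v 1]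

/-- The signed coordinate permutation `(x₀,x₁,x₂) ↦ (−x₂, −x₀, x₁)` on integer vectors (carries the frame of
`cert_A12_451` to the second twin completion of P₅). -/
def p5IsoBInt (v : Fin 3 → ℤ) : Fin 3 → ℤ := ![-v 2, -v 0, v 1]

/-- Table facts (one kernel `decide`): the slots / own vectors of `cert_C12_55` and `cert_A12_451`, the patterns
`fccInt` / `hcpInt`, and the integer maps `p5IsoAInt` / `p5IsoBInt` fit together as claimed. -/
theorem p5_tables :
    Finset.univ.image cert_C12_55.slot = p5FccInt ∧
    Finset.univ.image cert_C12_55.ownVec ⊆ p5OwnInt ∧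
    p5OwnInt ∪ p5FccInt = fccInt ∧
    (Finset.univ.image cert_A12_451.slot).image p5IsoAInt = p5TwinAInt ∧
    (Finset.univ.image cert_A12_451.slot).image p5IsoBInt = p5TwinBInt ∧
    (Finset.univ.image cert_A12_451.ownVec).image p5IsoAInt ⊆ p5OwnInt.image (fun v => (3 : ℕ) • v) ∧
    (Finset.univ.image cert_A12_451.ownVec).image p5IsoBInt ⊆ p5OwnInt.image (fun v => (3 : ℕ) • v) ∧
    hcpInt.image p5IsoAInt = p5OwnInt.image (fun v => (3 : ℕ) • v) ∪ p5TwinAInt ∧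
    hcpInt.image p5IsoBInt = p5OwnInt.image (fun v => (3 : ℕ) • v) ∪ p5TwinBInt ∧
    fccInt.filter (fun v => 0 < dotInt v ![-1, -1, 0]) = p5OwnInt ∧
    (![-1, -1, 0] : Fin 3 → ℤ) ∈ fccInt := by
  decide

/-! ### The two signed coordinate permutations as linear isometries of `ℝ³` -/

/-- The linear isometry `(x₀,x₁,x₂) ↦ (−x₂, −x₀, −x₁)` of `ℝ³`. -/
def p5IsoA : EuclideanSpace ℝ (Fin 3) ≃ₗᵢ[ℝ] EuclideanSpace ℝ (Fin 3) where
  toFun x := !₂[-x 2, -x 0, -x 1]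
  invFun y := !₂[-y 1, -y 2, -y 0]
  map_add' x y := by ext i; fin_cases i <;> simp <;> ring
  map_smul' c x := by ext i; fin_cases i <;> simp
  left_inv x := by ext i; fin_cases i <;> simp
  right_inv y := by ext i; fin_cases i <;> simp
  norm_map' x := by
    simp only [EuclideanSpace.norm_eq, Fin.sum_univ_three]
    congr 1
    simp only [LinearEquiv.coe_mk]
    simp
    ring

/-- The linear isometry `(x₀,x₁,x₂) ↦ (−x₂, −x₀, x₁)` of `ℝ³`. -/
def p5IsoB : EuclideanSpace ℝ (Fin 3) ≃ₗᵢ[ℝ] EuclideanSpace ℝ (Fin 3) where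
  toFun x := !₂[-x 2, -x 0, x 1]
  invFun y := !₂[-y 1, y 2, -y 0]
  map_add' x y := by ext i; fin_cases i <;> simp <;> ring
  map_smul' c x := by ext i; fin_cases i <;> simp
  left_inv x := by ext i; fin_cases i <;> simp
  right_inv y := by ext i; fin_cases i <;> simp
  norm_map' x := by
    simp only [EuclideanSpace.norm_eq, Fin.sum_univ_three]
    congr 1
    simp only [LinearEquiv.coe_mk]
    simp
    ring

/-- `p5IsoA` on integer vectors. -/
theorem p5IsoA_intVec (v : Fin 3 → ℤ) : p5IsoA (intVec v) = intVec (p5IsoAInt v) := by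
  ext i; fin_cases i <;> simp [p5IsoA, p5IsoAInt, intVec]

/-- `p5IsoB` on integer vectors. -/
theorem p5IsoB_intVec (v : Fin 3 → ℤ) : p5IsoB (intVec v) = intVec (p5IsoBInt v) := by
  ext i; fin_cases i <;> simp [p5IsoB, p5IsoBInt, intVec]

/-- A linear isometry acting on integer vectors through an integer map transports scaled patterns. -/
theorem image_scaledPattern_of_intMap (L : EuclideanSpace ℝ (Fin 3) ≃ₗᵢ[ℝ] EuclideanSpace ℝ (Fin 3))
    (g : (Fin 3 → ℤ) → (Fin 3 → ℤ)) (hL : ∀ v, L (intVec v) = intVec (g v)) (S : Finset (Fin 3 → ℤ)) (N : ℕ) :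
    (scaledPattern S N).image L = scaledPattern (S.image g) N := by
  classical
  unfold scaledPattern
  rw [Finset.image_image, Finset.image_image]
  refine Finset.image_congr fun v _ => ?_
  show L ((Real.sqrt N)⁻¹ • intVec v) = (Real.sqrt N)⁻¹ • intVec (g v)
  rw [L.map_smul, hL]

/-- Scale change `√18 = 3·√2`: tripling the integer vectors and the scale gives the same pattern. -/
theorem scaledPattern_image_three (S : Finset (Fin 3 → ℤ)) :
    scaledPattern (S.image fun v => (3 : ℕ) • v) 18 = scaledPattern S 2 := by
  classical
  unfold scaledPattern
  rw [Finset.image_image]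
  refine Finset.image_congr fun v _ => ?_
  show (Real.sqrt (18 : ℕ))⁻¹ • intVec ((3 : ℕ) • v) = (Real.sqrt (2 : ℕ))⁻¹ • intVec v
  have h18 : Real.sqrt ((18 : ℕ) : ℝ) = 3 * Real.sqrt ((2 : ℕ) : ℝ) := by
    rw [show ((18 : ℕ) : ℝ) = 3 ^ 2 * ((2 : ℕ) : ℝ) by norm_num, Real.sqrt_mul (by norm_num), Real.sqrt_sq (by norm_num)]
  rw [intVec_nsmul, h18, smul_smul]
  congr 1
  have h2 : Real.sqrt ((2 : ℕ) : ℝ) ≠ 0 := by positivity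
  field_simp
  push_cast
  ring

/-! ### The P₅ row in the kernel's vocabulary -/

/-- **The P₅ own pattern** (`O`, five unit vectors): the closed vertex star of `(−1,−1,0)/√2` in the cuboctahedron —
the own pattern of the landed cone certificate `cert_C12_55` (fcc orbit C12-55 ≅ hcp orbit A12-451). -/
def p5Own : Finset (EuclideanSpace ℝ (Fin 3)) := scaledPattern p5OwnInt 2

/-- The free part of the cuboctahedral completion of P₅ (`= {cert_C12_55.s i}`, sequel). -/
def p5SpecFcc : Finset (EuclideanSpace ℝ (Fin 3)) := scaledPattern p5FccInt 2

/-- The free part of the first twin (anticuboctahedral) completion of P₅ (`= p5IsoA {cert_A12_451.s i}`, sequel). -/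
def p5SpecTwinA : Finset (EuclideanSpace ℝ (Fin 3)) := scaledPattern p5TwinAInt 18

/-- The free part of the second twin (anticuboctahedral) completion of P₅ (`= p5IsoB {cert_A12_451.s i}`, sequel). -/
def p5SpecTwinB : Finset (EuclideanSpace ℝ (Fin 3)) := scaledPattern p5TwinBInt 18

/-- Per-ball tube radii (×1000) of `cert_C12_55`, in its slot order (`cert_C12_55_rhoAt_0…6`, `…ConeCertRhoAtP5`). -/
def p5RhoFcc : Fin 7 → ℕ := ![74, 141, 141, 74, 141, 141, 201]

/-- Per-ball tube radii (×1000) of `cert_A12_451`, in its slot order (`cert_A12_451_rhoAt_0…6`, `…ConeCertRhoAtP5`). -/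
def p5RhoHcp : Fin 7 → ℕ := ![108, 115, 115, 108, 106, 96, 133]

/-- The per-slot tube radius of the cuboctahedral completion (`p5RhoFcc i / 1000` at `cert_C12_55.s i`, else `0`). -/
def p5RadFcc (x : EuclideanSpace ℝ (Fin 3)) : ℝ :=
  ∑ i : Fin 7, if x = cert_C12_55.s i then (p5RhoFcc i : ℝ) / 1000 else 0

/-- The per-slot tube radius of the first twin completion (`p5RhoHcp i / 1000` at `p5IsoA (cert_A12_451.s i)`). -/
def p5RadTwinA (x : EuclideanSpace ℝ (Fin 3)) : ℝ :=
  ∑ i : Fin 7, if x = p5IsoA (cert_A12_451.s i) then (p5RhoHcp i : ℝ) / 1000 else 0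

/-- The per-slot tube radius of the second twin completion (`p5RhoHcp i / 1000` at `p5IsoB (cert_A12_451.s i)`). -/
def p5RadTwinB (x : EuclideanSpace ℝ (Fin 3)) : ℝ :=
  ∑ i : Fin 7, if x = p5IsoB (cert_A12_451.s i) then (p5RhoHcp i : ℝ) / 1000 else 0

/-- **`P5Exhaustion` — the E1 row P₅ in CERTIFIED NORMAL FORM.**  Every twelve-point kissing completion `N ⊇ O` of
the P₅ own pattern `O = p5Own` (around the origin) has its free part `N ∖ O` SLOT-MATCHED — a bijection onto the
special completion moving each point by a chord smaller than the per-ball tube radius of its slot — to the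
cuboctahedral completion `p5SpecFcc` (radii `p5RadFcc`) or to one of the two twin completions `p5SpecTwinA/B`
(radii `p5RadTwinA/B`).  The radii are those of the LANDED per-ball tube theorems; the statement is exactly the
outside-tube half of the certification of the row (cf-p2 R38, PREREG §34.R2, row A12-451 ≅ C12-55: every box-tuple
of seven free contacts compatible with the five own balls is refuted or lies inside one of these tubes — the
own-tube pieces with joint `ε ≤ 0.069` included).  NAMED COMPUTATIONAL HYPOTHESIS (certified computation, not a
kernel proof); its kernel consequence `ExactOnly 0 p5Own` is `exactOnly_p5Own_of_exhaustion` (sequel). -/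
def P5Exhaustion : Prop :=
  ∀ N : Finset (EuclideanSpace ℝ (Fin 3)), p5Own ⊆ N → N.card = 12 → IsKissingAround 0 N →
    SlotMatched p5RadFcc (N \ p5Own) p5SpecFcc ∨
    SlotMatched p5RadTwinA (N \ p5Own) p5SpecTwinA ∨
    SlotMatched p5RadTwinB (N \ p5Own) p5SpecTwinB

/-! ### Transport of slot matchings and the per-certificate tube step -/

/-- Membership in the image of a finset under a linear isometry. -/
theorem mem_image_linearIsometryEquiv_iff {T : Finset (EuclideanSpace ℝ (Fin 3))}
    (L : EuclideanSpace ℝ (Fin 3) ≃ₗᵢ[ℝ] EuclideanSpace ℝ (Fin 3)) {x : EuclideanSpace ℝ (Fin 3)} :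
    x ∈ T.image L ↔ L.symm x ∈ T := by
  constructor
  · intro hx
    obtain ⟨t, ht, rfl⟩ := Finset.mem_image.1 hx
    rwa [L.symm_apply_apply]
  · intro hx
    exact Finset.mem_image.2 ⟨L.symm x, hx, L.apply_symm_apply x⟩

/-- A slot matching is transported by a linear isometry (the radius function is pulled back). -/
theorem SlotMatched.image_linearIsometryEquiv {ρ : EuclideanSpace ℝ (Fin 3) → ℝ}
    {T P : Finset (EuclideanSpace ℝ (Fin 3))} (h : SlotMatched ρ T P)
    (L : EuclideanSpace ℝ (Fin 3) ≃ₗᵢ[ℝ] EuclideanSpace ℝ (Fin 3)) :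
    SlotMatched (fun x => ρ (L.symm x)) (T.image L) (P.image L) := by
  classical
  obtain ⟨e, he⟩ := h
  refine ⟨{ toFun := fun x => ⟨L (e ⟨L.symm x, (mem_image_linearIsometryEquiv_iff L).1 x.2⟩),
              Finset.mem_image_of_mem _ (e _).2⟩,
            invFun := fun y => ⟨L (e.symm ⟨L.symm y, (mem_image_linearIsometryEquiv_iff L).1 y.2⟩),
              Finset.mem_image_of_mem _ (e.symm _).2⟩,
            left_inv := ?_, right_inv := ?_ }, ?_⟩
  · intro x
    ext
    simp only [LinearIsometryEquiv.symm_apply_apply, Subtype.coe_eta, Equiv.symm_apply_apply,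
      LinearIsometryEquiv.apply_symm_apply]
  · intro y
    ext
    simp only [LinearIsometryEquiv.symm_apply_apply, Subtype.coe_eta, Equiv.apply_symm_apply,
      LinearIsometryEquiv.apply_symm_apply]
  · intro x
    show dist (x : EuclideanSpace ℝ (Fin 3)) (L (e ⟨L.symm x, _⟩)) < ρ (L.symm (L (e ⟨L.symm x, _⟩)))
    have hx := he ⟨L.symm x, (mem_image_linearIsometryEquiv_iff L).1 x.2⟩
    rw [L.symm_apply_apply]
    calc dist (x : EuclideanSpace ℝ (Fin 3)) (L (e ⟨L.symm x, (mem_image_linearIsometryEquiv_iff L).1 x.2⟩))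
        = dist (L (L.symm x)) (L (e ⟨L.symm x, (mem_image_linearIsometryEquiv_iff L).1 x.2⟩)) := by
          rw [L.apply_symm_apply]
      _ = dist (L.symm x) (e ⟨L.symm x, (mem_image_linearIsometryEquiv_iff L).1 x.2⟩ : EuclideanSpace ℝ (Fin 3)) :=
          L.dist_map _ _
      _ < _ := hx

/-- **The tube step for one special completion, transported.**  A valid cone certificate `C` with per-ball radii
`p i / q`, a radius function `ρ` not exceeding them on the transported slots, and a linear isometry `L` carrying the
certificate's active own balls into the own pattern `O`: if the free part `N ∖ O` of a kissing completion `N ⊇ O`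
(around the origin) is slot-matched with radii `ρ` to the transported slot set `L {C.s i}`, then it IS that set. -/
theorem sdiff_eq_of_coneCert {m : ℕ} (C : ConeCert m) (hV : C.check = true) {p : Fin m → ℕ} {q : ℕ}
    (hρ : ∀ i, C.rhoCheckAt i (p i) q = true) (hinj : ∀ i j, C.slot i = C.slot j → i = j)
    (L : EuclideanSpace ℝ (Fin 3) ≃ₗᵢ[ℝ] EuclideanSpace ℝ (Fin 3))
    {ρ : EuclideanSpace ℝ (Fin 3) → ℝ} (hρle : ∀ i, ρ (L (C.s i)) ≤ (p i : ℝ) / q)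
    {O N : Finset (EuclideanSpace ℝ (Fin 3))} (hown : C.ownSet.image L ⊆ O) (hON : O ⊆ N)
    (hk : IsKissingAround 0 N)
    (hm : SlotMatched ρ (N \ O) ((Finset.univ.image C.s).image L)) :
    N \ O = (Finset.univ.image C.s).image L := by
  classical
  set T := N \ O with hT
  -- pull back by `L`
  have hm' : SlotMatched (fun x => ρ (L x)) (T.image L.symm) (Finset.univ.image C.s) := by
    have h := hm.image_linearIsometryEquiv L.symm
    rw [Finset.image_image, show (⇑L.symm ∘ ⇑L) = id from funext fun x => L.symm_apply_apply x,
      Finset.image_id] at h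
    simpa only [LinearIsometryEquiv.symm_symm] using h
  have hT1 : ∀ t ∈ T.image L.symm, ‖t‖ = 1 := by
    intro t ht
    obtain ⟨u, hu, rfl⟩ := Finset.mem_image.1 ht
    rw [LinearIsometryEquiv.norm_map, ← dist_zero_left]
    exact hk.1 u (Finset.sdiff_subset hu)
  have hTo : ∀ t ∈ T.image L.symm, ∀ o ∈ C.ownSet, 1 ≤ dist t o := by
    intro t ht o ho
    obtain ⟨u, hu, rfl⟩ := Finset.mem_image.1 ht
    have hLo : L o ∈ O := hown (Finset.mem_image_of_mem _ ho)
    have hu' := Finset.mem_sdiff.1 hu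
    have hne : u ≠ L o := fun h => hu'.2 (h ▸ hLo)
    have h1 := hk.2 u hu'.1 (L o) (hON hLo) hne
    rwa [← L.symm.dist_map, L.symm_apply_apply] at h1
  have hTT : ∀ t ∈ T.image L.symm, ∀ t' ∈ T.image L.symm, t ≠ t' → 1 ≤ dist t t' := by
    intro t ht t' ht' htt
    obtain ⟨u, hu, rfl⟩ := Finset.mem_image.1 ht
    obtain ⟨u', hu', rfl⟩ := Finset.mem_image.1 ht'
    have hne : u ≠ u' := fun h => htt (by rw [h])
    rw [L.symm.dist_map]
    exact hk.2 u (Finset.sdiff_subset hu) u' (Finset.sdiff_subset hu') hne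
  have heq : T.image L.symm = Finset.univ.image C.s :=
    C.eq_slotSet_of_slotMatched hV hρ hinj (ρ := fun x => ρ (L x)) hρle hT1 hTo hTT hm'
  calc T = (T.image L.symm).image L := by
          rw [Finset.image_image, show (⇑L ∘ ⇑L.symm) = id from funext fun x => L.apply_symm_apply x,
            Finset.image_id]
    _ = (Finset.univ.image C.s).image L := by rw [heq]

/-- The UNIFORM-radius reading of the row (cuboctahedral tube `74/1000`, twin tubes `96/1000` — the minima of the
per-ball radii, = the aggregate radii of `…ConeCertRhoP5`) implies `P5Exhaustion`. -/
theorem p5Exhaustion_of_uniform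
    (h : ∀ N : Finset (EuclideanSpace ℝ (Fin 3)), p5Own ⊆ N → N.card = 12 → IsKissingAround 0 N →
      SlotMatched (fun _ => 74 / 1000) (N \ p5Own) p5SpecFcc ∨
      SlotMatched (fun _ => 96 / 1000) (N \ p5Own) p5SpecTwinA ∨
      SlotMatched (fun _ => 96 / 1000) (N \ p5Own) p5SpecTwinB) :
    P5Exhaustion := by
  classical
  intro N hON hcard hk
  -- every radius function is at least the uniform value ON ITS SLOT SET, which is all a matching uses
  have key : ∀ {r : ℝ} {ρ : EuclideanSpace ℝ (Fin 3) → ℝ} {P : Finset (EuclideanSpace ℝ (Fin 3))},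
      (∀ x ∈ P, r ≤ ρ x) → SlotMatched (fun _ => r) (N \ p5Own) P → SlotMatched ρ (N \ p5Own) P := by
    intro r ρ P hP hm
    obtain ⟨e, he⟩ := hm
    exact ⟨e, fun t => lt_of_lt_of_le (he t) (hP _ (e t).2)⟩
  rcases h N hON hcard hk with hm | hm | hm
  · refine Or.inl (key (fun x hx => ?_) hm)
    -- `x` is a slot of `cert_C12_55`
    have hx' : x ∈ Finset.univ.image cert_C12_55.s := by
      rw [ConeCert.image_s_eq_scaledPattern, p5_tables.1]; exact hx
    obtain ⟨i, -, rfl⟩ := Finset.mem_image.1 hx'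
    have hsinj : Function.Injective cert_C12_55.s := cert_C12_55.s_injective cert_C12_55_valid cert_C12_55_slotInj
    rw [p5RadFcc, Finset.sum_eq_single i (fun j _ hj => if_neg fun h => hj (hsinj h).symm) (by simp), if_pos rfl]
    fin_cases i <;> norm_num [p5RhoFcc]
  · refine Or.inr (Or.inl (key (fun x hx => ?_) hm))
    have hx' : x ∈ (Finset.univ.image cert_A12_451.s).image p5IsoA := by
      rw [ConeCert.image_s_eq_scaledPattern, image_scaledPattern_of_intMap p5IsoA p5IsoAInt p5IsoA_intVec,
        p5_tables.2.2.2.1]; exact hx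
    obtain ⟨y, hy, rfl⟩ := Finset.mem_image.1 hx'
    obtain ⟨i, -, rfl⟩ := Finset.mem_image.1 hy
    have hsinj : Function.Injective fun i => p5IsoA (cert_A12_451.s i) :=
      p5IsoA.injective.comp (cert_A12_451.s_injective cert_A12_451_valid cert_A12_451_slotInj)
    rw [p5RadTwinA, Finset.sum_eq_single i (fun j _ hj => if_neg fun h => hj (hsinj h).symm) (by simp), if_pos rfl]
    fin_cases i <;> norm_num [p5RhoHcp]
  · refine Or.inr (Or.inr (key (fun x hx => ?_) hm))
    have hx' : x ∈ (Finset.univ.image cert_A12_451.s).image p5IsoB := by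
      rw [ConeCert.image_s_eq_scaledPattern, image_scaledPattern_of_intMap p5IsoB p5IsoBInt p5IsoB_intVec,
        p5_tables.2.2.2.2.1]; exact hx
    obtain ⟨y, hy, rfl⟩ := Finset.mem_image.1 hx'
    obtain ⟨i, -, rfl⟩ := Finset.mem_image.1 hy
    have hsinj : Function.Injective fun i => p5IsoB (cert_A12_451.s i) :=
      p5IsoB.injective.comp (cert_A12_451.s_injective cert_A12_451_valid cert_A12_451_slotInj)
    rw [p5RadTwinB, Finset.sum_eq_single i (fun j _ hj => if_neg fun h => hj (hsinj h).symm) (by simp), if_pos rfl]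
    fin_cases i <;> norm_num [p5RhoHcp]

end Summit.Ventures.Crystal3D.Theorems

end
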